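import Summits.KontsevichZagierPeriods.Zeta5Search.LaiSweepShard

/-!
# `κ₃` sweep certificate — shard file 079 of 127 (shards 553–559 of 889)

HONEST FRAMING. Systematic search; no irrationality claim unless certified. This file only checks,
by `decide +kernel`, shards 553–559 of the order-cell sweep of the `κ₃` point `(74, 2180, 444; δ74)`
(engine `LaiSweepEngine`, soundness `LaiSweepJump/Free/Eval/Shard/Kappa3`; a shard is `⟨regime, n,
p, q, p', q', Lo, Up⟩`: `n` cells from `p/q` to `p'/q'` with integer rate sums in `[Lo, Up]`, `K =
128`, `D = 2^40`). It draws NO conclusion: only the capstone `LaiKappa3SweepCert`, which needs all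
127 shard files, does. Kernel cost of this file ≈ 560 cells × 0.3 s.
-/

namespace Summit.KontsevichZagierPeriods.Zeta5Search.Sweep

set_option maxHeartbeats 100000000 in
/-- Shard 553: 80 cells of regime B from `119/206` to `257/444`.
[cite: Lai2024BallRivoal, §4 Lemma 4.3] -/
theorem shard553 :
    Shard.check 128 (2^40)
      ⟨true, 80, 119, 206, 257, 444, 12541601846090, 16228823184160⟩ = true := by
  decide +kernel

set_option maxHeartbeats 100000000 in
/-- Shard 554: 80 cells of regime B from `257/444` to `123/212`.
[cite: Lai2024BallRivoal, §4 Lemma 4.3] -/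
theorem shard554 :
    Shard.check 128 (2^40)
      ⟨true, 80, 257, 444, 123, 212, 14688437541164, 19026169291166⟩ = true := by
  decide +kernel

set_option maxHeartbeats 100000000 in
/-- Shard 555: 80 cells of regime B from `123/212` to `182/313`.
[cite: Lai2024BallRivoal, §4 Lemma 4.3] -/
theorem shard555 :
    Shard.check 128 (2^40)
      ⟨true, 80, 123, 212, 182, 313, 13820404833144, 17920603508873⟩ = true := by
  decide +kernel

set_option maxHeartbeats 100000000 in
/-- Shard 556: 80 cells of regime B from `182/313` to `229/393`.
[cite: Lai2024BallRivoal, §4 Lemma 4.3] -/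
theorem shard556 :
    Shard.check 128 (2^40)
      ⟨true, 80, 182, 313, 229, 393, 13217528763067, 17155930196683⟩ = true := by
  decide +kernel

set_option maxHeartbeats 100000000 in
/-- Shard 557: 80 cells of regime B from `229/393` to `153/262`.
[cite: Lai2024BallRivoal, §4 Lemma 4.3] -/
theorem shard557 :
    Shard.check 128 (2^40)
      ⟨true, 80, 229, 393, 153, 262, 13685173247164, 17781094242748⟩ = true := by
  decide +kernel

set_option maxHeartbeats 100000000 in
/-- Shard 558: 80 cells of regime B from `153/262` to `182/311`.
[cite: Lai2024BallRivoal, §4 Lemma 4.3] -/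
theorem shard558 :
    Shard.check 128 (2^40)
      ⟨true, 80, 153, 262, 182, 311, 13307829849470, 17307831131540⟩ = true := by
  decide +kernel

set_option maxHeartbeats 100000000 in
/-- Shard 559: 80 cells of regime B from `182/311` to `78/133`.
[cite: Lai2024BallRivoal, §4 Lemma 4.3] -/
theorem shard559 :
    Shard.check 128 (2^40)
      ⟨true, 80, 182, 311, 78, 133, 13489220595499, 17561385376362⟩ = true := by
  decide +kernel

/-- The checked shards of this file, in order. [folklore] -/
def shards079 : List (CheckedShard 128 (2^40)) :=
  [⟨_, shard553⟩, ⟨_, shard554⟩, ⟨_, shard555⟩, ⟨_, shard556⟩, ⟨_, shard557⟩,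
    ⟨_, shard558⟩, ⟨_, shard559⟩]

end Summit.KontsevichZagierPeriods.Zeta5Search.Sweep
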